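import Summits.QuantumFields.YangMills.Theorems.BalabanUVNodesN21ResponseRoadAtRegularSet
import Literature.MathematicalPhysics.QuantumFieldTheory.Balaban1983to89.B11Claim309UAnalytic

/-!
# N21 (NE7c) · THE MINIMISER'S RESPONSE IN [14] PROP. 6's LETTERS: the response road's NODE-O clause from a uniform
# contraction REGIME (117)–(121) for the scheme (116), analytic data (p. 309) and an analytic fine chart — BY NAME

Width seat `pub-ymgap-dag-n21-w7` (g0′, harness re-seat; dag-lead WIDTH-209 N21 piece 1 «RADIAL TRANSVERSALITY (α)»,
its [14]-regularity rung, third shape), node N21 = NE7c (NOT PRINTED in [Bałaban 1983–89], NOT proved), lane K3⁷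
`SpineGivenEndpointR13SepCoPH` (stmt-QuantumFields-20544, `--kind proof --supports … --as helper`).  File 3 of this seat
(file 1 `…N21MinimiserResponseImplicitFunction` p607125 ✓, file 2 `…N21MinimiserResponseContraction` p609704 ✓ are its
siblings, not imported); consumes BY NAME lit-balaban r08 g9's `B11Claim309UAnalytic` (`analyticAt_solA`,
`contDiffAt_mapT`, `norm_fderiv_mapT_lt_one`, `analyticAt_W_section`), `B11Eq174Chart` (`Regime`, `solA`,
`Regime.solA_mem`), `B11Prop6Scheme` (`mapT`, `lipschitz_120`, `norm_arg_lt`), n21-w3 f7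
`…N21ExponentialChartFieldStrength` (`isOpen_regularConfigs`, `isOpen_unitConfigs`, `differentiableOn_plaqReading`) and f8
`…N21ResponseRoadAtRegularSet` (p598568 ✓: ★★★ `hRT_of_blockExpChart_regular`).

WHY.  File 1 produced f8's NODE-O clause `hΨd` («the plaquette reading of the minimiser is ℂ-differentiable in the block
variables on the regular set») from an ABSTRACT critical branch; file 2 from an abstract CONTRACTING FAMILY `T z V`
(binders `hfix` ∕ `hlip` ∕ `hT` ∕ `hlt` ∕ `hunit`).  Print NAMES the family: [14] = CMP 102 (1985) 277, Prop. 6 pp. 295–296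
— the map (116) `X ↦ −𝔊J − 𝔊((δ∕δA′)V)(X + H₁B)` (`mapT 𝒢 Λ W J 𝔄`, `Λ = 0` printed) on the ball (115) `‖X‖ ≤ ε₄`, a
self-map and a contraction with constant `4B₀C₄(ε₄ + B₀|B|) < 1` under (117)–(121) (`Regime 𝒢 Λ W B₀ θ C₄ a₃ j a ε₄`,
`‖J‖ ≤ j`, `‖𝔄‖ < a`), whose unique fixed point `𝒜 = solA …` is «an analytic function» of the data (p. 296; p. 309
«They are analytic functions of these configurations … the equations determine an analytic function 𝓗» —
`analyticOnNhd_solA`).  THIS FILE reads f8's clause in THOSE letters: (§1) under a uniform `Regime` with analytic data,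
print's scheme INSTANTIATES file 2's binder system (`T := mapT`, `K := closedBall 0 ε₄`, `q := θ + 4B₀C₄(ε₄ + a)`,
`F := solA`) BY NAME, and the reading `u ↦ Φ u (𝒜(u) + 𝔄(u))` through any jointly analytic `Φ` is analytic; (§2) f8's
`hΨd` VERBATIM for a selector READING the solution through an analytic fine chart, `Umin z V = Φ z V (𝒜 z V + 𝔄 z V)`
on the regular set (`Φ` LOCATED: «(47)'s map `T` followed by the exponential about the background», Sect. G
(174)∕(179); not asserted); (§3) part 34's `hRT` with that half of the NODE-O clause DISCHARGED into REGIME letters —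
f8 ★★★ BY NAME; (§4) the kept binder system is jointly inhabited.

WHAT IS PROVED ([bookkeeping] BY NAME; 0 def, 0 sorry).
* §1 `contractingFamily_of_regime` (file 2's five binders `hfix` ∕ `hlip` ∕ `q < 1` ∕ `hT` ∕ `hlt`, pointwise on the open
  parameter set) · `analyticOnNhd_read_solA` (`u ↦ Φ u (𝒜 u + 𝔄 u)` analytic on `𝒪`; r08's `analyticOnNhd_chartH`
  with a general codomain).
* §2 ★★-R `psiClause_differentiableOn_of_regime` · ★★′-R `psiClause_plaqReading_of_regime` = f8's `hΨd` VERBATIM.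
* §3 ★★★-R `hRT_of_blockExpChart_regular_of_regime` = f8 ★★★ BY NAME, `hΨd` DISCHARGED by ★★′-R; displayed instead:
  `Regime` rows on `Reg`, data bounds, analyticity of `𝒢 Λ W J H₁B` in the block variables, the fine chart `Φ`, the
  reading identity, unit values, `hΨS` ([14] Thm 1 (8), LOCATED); every other binder of f8 verbatim.
* §4 A2∕A6 `regime_levelZero_witness`: the binders KEPT by ★★′-R ∕ ★★★-R are JOINTLY INHABITED in every `𝔄` — zero
  data, `Regime 0 0 0 0 0 0 2 0 1 0`, `Φ z V Y := V`, `Umin z V := V` (level 0; HONESTLY LABELLED).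

HONEST FRAMING.  [bookkeeping]; the identification of `𝒢, Λ, W, J, H₁B` with [14]'s data AT NODE 00's objects, of `Φ`
with the exponential fine chart and of `Umin` with [14]'s minimiser is a LOCATED dictionary, NOT asserted — print
itself takes the analyticity and bounds of these data from [4–6] (lit-balaban (M2)); (α) itself (radial growth at rate
`κ₀θ(1 − ρ)` on the shell) NOT PRINTED ∕ NOT proved; nothing of Bałaban's asserted; (M1) ∕ NE7c NOT PRINTED ∕ NOT
proved; N21 NOT discharged; K3⁷ NOT claimed; counts unmoved (typed 28∕28 · discharged 5∕27, A 5∕28); count-neutral;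
one finite 𝕋⁴ at fixed ε — the Yang–Mills mass gap (Clay) is NOT proved by any of this: R4 would close the conditional
finite-𝕋⁴ rung `BalabanLadder.UV` only; nothing continuum ∕ ℝ⁴ ∕ OS ∕ mass gap ∕ Clay.
-/

noncomputable section

open Filter Set Metric NormedSpace MeasureTheory Matrix
open scoped Topology ContDiff ENNReal

namespace Summit.QuantumFields.YangMills.Theorems.N21MinimiserResponseRegime

open Literature.MathematicalPhysics.QuantumFieldTheory.Balaban1983to89.B11Prop6Scheme (mapT lipschitz_120 norm_arg_lt)
open Literature.MathematicalPhysics.QuantumFieldTheory.Balaban1983to89.B11Eq174Chart (Regime solA)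
open Literature.MathematicalPhysics.QuantumFieldTheory.Balaban1983to89.B11Claim309UAnalytic
  (analyticAt_solA contDiffAt_mapT norm_fderiv_mapT_lt_one analyticAt_W_section)
open Summit.QuantumFields.YangMills.Theorems.N21ExponentialChartFieldStrength
  (isOpen_unitConfigs isOpen_regularConfigs differentiableOn_plaqReading)
open Summit.QuantumFields.YangMills.Theorems.N21ResponseRoadAtRegularSet (hRT_of_blockExpChart_regular)

/-! ## §1  Print's scheme (116) under a uniform contraction regime IS a contracting family; readings of its solution -/

section Scheme

variable {𝒰 𝒴 𝒵 : Type*} [NormedAddCommGroup 𝒰] [NormedSpace ℂ 𝒰] [CompleteSpace 𝒰]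
  [NormedAddCommGroup 𝒴] [NormedSpace ℂ 𝒴] [CompleteSpace 𝒴] [NormedAddCommGroup 𝒵] [NormedSpace ℂ 𝒵] [CompleteSpace 𝒵]
  {𝒪 : Set 𝒰} {𝒢 : 𝒰 → (𝒵 →L[ℂ] 𝒴)} {Λ : 𝒰 → (𝒴 →L[ℂ] 𝒴)} {W : 𝒰 → 𝒴 → 𝒵} {J : 𝒰 → 𝒵} {𝔄 : 𝒰 → 𝒴}
  {B₀ θ C₄ a₃ j a ε₄ : ℝ}

omit [CompleteSpace 𝒰] in
/-- **PRINT'S SCHEME IS A CONTRACTING FAMILY — file 2's binder system BY NAME**: for data `𝒢 Λ W J 𝔄` under a UNIFORM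
`Regime … B₀ θ C₄ a₃ j a ε₄` on the parameter set `𝒪` with `‖J‖ ≤ j`, `‖𝔄‖ < a`, `𝒢 Λ J 𝔄` analytic on `𝒪` and
`W = (δ∕δA′)V` jointly analytic on `𝒪 ×ˢ {‖Y‖ < a₃}`, the map (116) `T u := mapT (𝒢 u) (Λ u) (W u) (J u) (𝔄 u)`, the
ball (115) `K := closedBall 0 ε₄`, the constant `q := θ + 4B₀C₄(ε₄ + a)` of (120)–(121) and the solution
`F u := solA …` satisfy, at every `u ∈ 𝒪`: `hfix` (`Regime.solA_mem`), `hlip` (`lipschitz_120`), `q < 1` (`Regime.contr`),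
`hT` (`contDiffAt_mapT`) and `hlt` (`norm_fderiv_mapT_lt_one`).
[cite: Balaban1985Variational, (115)-(121) pp.295-296, p.309] [bookkeeping] -/
theorem contractingFamily_of_regime (R : ∀ u ∈ 𝒪, Regime (𝒢 u) (Λ u) (W u) B₀ θ C₄ a₃ j a ε₄)
    (hJb : ∀ u ∈ 𝒪, ‖J u‖ ≤ j) (h𝔄b : ∀ u ∈ 𝒪, ‖𝔄 u‖ < a)
    (h𝒢 : AnalyticOnNhd ℂ 𝒢 𝒪) (hΛ : AnalyticOnNhd ℂ Λ 𝒪)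
    (hW : AnalyticOnNhd ℂ (fun p : 𝒰 × 𝒴 => W p.1 p.2) (𝒪 ×ˢ {Y : 𝒴 | ‖Y‖ < a₃})) (hJ : AnalyticOnNhd ℂ J 𝒪)
    (h𝔄 : AnalyticOnNhd ℂ 𝔄 𝒪) :
    ∀ u ∈ 𝒪,
      (solA (𝒢 u) (Λ u) (W u) (J u) ε₄ (𝔄 u) ∈ closedBall (0 : 𝒴) ε₄ ∧
        mapT (𝒢 u) (Λ u) (W u) (J u) (𝔄 u) (solA (𝒢 u) (Λ u) (W u) (J u) ε₄ (𝔄 u)) =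
          solA (𝒢 u) (Λ u) (W u) (J u) ε₄ (𝔄 u)) ∧
      (∀ x ∈ closedBall (0 : 𝒴) ε₄, ∀ y ∈ closedBall (0 : 𝒴) ε₄,
        ‖mapT (𝒢 u) (Λ u) (W u) (J u) (𝔄 u) x - mapT (𝒢 u) (Λ u) (W u) (J u) (𝔄 u) y‖ ≤
          (θ + 4 * B₀ * C₄ * (ε₄ + a)) * ‖x - y‖) ∧
      θ + 4 * B₀ * C₄ * (ε₄ + a) < 1 ∧
      ContDiffAt ℂ ω (fun z : 𝒰 × 𝒴 => mapT (𝒢 z.1) (Λ z.1) (W z.1) (J z.1) (𝔄 z.1) z.2)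
        (u, solA (𝒢 u) (Λ u) (W u) (J u) ε₄ (𝔄 u)) ∧
      ‖fderiv ℂ (mapT (𝒢 u) (Λ u) (W u) (J u) (𝔄 u)) (solA (𝒢 u) (Λ u) (W u) (J u) ε₄ (𝔄 u))‖ < 1 := by
  intro u hu
  have hm := (R u hu).solA_mem (hJb u hu) (h𝔄b u hu)
  have hX₀ : ‖solA (𝒢 u) (Λ u) (W u) (J u) ε₄ (𝔄 u)‖ ≤ ε₄ := hm.1
  refine ⟨⟨mem_closedBall_zero_iff.mpr hX₀, hm.2⟩, fun x hx y hy => ?_, (R u hu).contr, ?_, ?_⟩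
  · exact lipschitz_120 (J := J u) (R u hu).norm_G (R u hu).norm_L (R u hu).quad (R u hu).B₀_nonneg
      (R u hu).C₄_nonneg (h𝔄b u hu) (R u hu).ε₄_nonneg (R u hu).dom (mem_closedBall_zero_iff.mp hx)
      (mem_closedBall_zero_iff.mp hy)
  · have harg : ‖solA (𝒢 u) (Λ u) (W u) (J u) ε₄ (𝔄 u) + 𝔄 u‖ < a₃ := by
      have h := norm_arg_lt (h𝔄b u hu) hX₀
      linarith [(R u hu).dom, (R u hu).ε₄_nonneg, (norm_nonneg (𝔄 u)).trans_lt (h𝔄b u hu)]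
    exact contDiffAt_mapT h𝒢 hΛ hW hJ h𝔄 hu harg
  · have hWd : DifferentiableOn ℂ (W u) {Y : 𝒴 | ‖Y‖ < a₃} := fun Y hY =>
      (analyticAt_W_section (hW (u, Y) ⟨hu, hY⟩)).differentiableAt.differentiableWithinAt
    exact norm_fderiv_mapT_lt_one (J₀ := J u) (R u hu) hWd (h𝔄b u hu) hX₀

/-- **READINGS OF THE SOLUTION THROUGH A JOINTLY ANALYTIC CHART ARE ANALYTIC** (r08's `analyticOnNhd_chartH` with a
general codomain): under the uniform regime and the analyticity letters, for `Φ : 𝒰 → 𝒴 → 𝔉` jointly analytic on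
`𝒪 ×ˢ {‖Y‖ < ε₄ + a}` (the range of `𝒜(u) + 𝔄(u)`), the map `u ↦ Φ u (𝒜(u) + 𝔄(u))` is analytic on the open set
`𝒪` — `analyticAt_solA` BY NAME, composed. [cite: Balaban1985Variational, (174) p.305, (179) p.306, p.309]
[bookkeeping] -/
theorem analyticOnNhd_read_solA {𝔉 : Type*} [NormedAddCommGroup 𝔉] [NormedSpace ℂ 𝔉] (h𝒪 : IsOpen 𝒪)
    (R : ∀ u ∈ 𝒪, Regime (𝒢 u) (Λ u) (W u) B₀ θ C₄ a₃ j a ε₄)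
    (hJb : ∀ u ∈ 𝒪, ‖J u‖ ≤ j) (h𝔄b : ∀ u ∈ 𝒪, ‖𝔄 u‖ < a)
    (h𝒢 : AnalyticOnNhd ℂ 𝒢 𝒪) (hΛ : AnalyticOnNhd ℂ Λ 𝒪)
    (hW : AnalyticOnNhd ℂ (fun p : 𝒰 × 𝒴 => W p.1 p.2) (𝒪 ×ˢ {Y : 𝒴 | ‖Y‖ < a₃})) (hJ : AnalyticOnNhd ℂ J 𝒪)
    (h𝔄 : AnalyticOnNhd ℂ 𝔄 𝒪) {Φ : 𝒰 → 𝒴 → 𝔉}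
    (hΦ : AnalyticOnNhd ℂ (fun p : 𝒰 × 𝒴 => Φ p.1 p.2) (𝒪 ×ˢ {Y : 𝒴 | ‖Y‖ < ε₄ + a})) :
    AnalyticOnNhd ℂ (fun u : 𝒰 => Φ u (solA (𝒢 u) (Λ u) (W u) (J u) ε₄ (𝔄 u) + 𝔄 u)) 𝒪 := by
  intro u₀ hu₀
  have hsol := analyticAt_solA h𝒪 R hJb h𝔄b h𝒢 hΛ hW hJ h𝔄 hu₀
  have harg : AnalyticAt ℂ (fun u : 𝒰 => solA (𝒢 u) (Λ u) (W u) (J u) ε₄ (𝔄 u) + 𝔄 u) u₀ := hsol.add (h𝔄 u₀ hu₀)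
  have hin : AnalyticAt ℂ (fun u : 𝒰 => (u, solA (𝒢 u) (Λ u) (W u) (J u) ε₄ (𝔄 u) + 𝔄 u)) u₀ :=
    analyticAt_id.prod harg
  have hmem : ‖solA (𝒢 u₀) (Λ u₀) (W u₀) (J u₀) ε₄ (𝔄 u₀) + 𝔄 u₀‖ < ε₄ + a :=
    norm_arg_lt (h𝔄b u₀ hu₀) ((R u₀ hu₀).solA_mem (hJb u₀ hu₀) (h𝔄b u₀ hu₀)).1
  have hΦ₀ : AnalyticAt ℂ (fun p : 𝒰 × 𝒴 => Φ p.1 p.2)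
      (u₀, solA (𝒢 u₀) (Λ u₀) (W u₀) (J u₀) ε₄ (𝔄 u₀) + 𝔄 u₀) := hΦ _ ⟨hu₀, hmem⟩
  have h := AnalyticAt.comp_of_eq hΦ₀ hin rfl
  simpa [Function.comp_def] using h

end Scheme

/-! ## §2  The response road's NODE-O clause (f8's `hΨd`) from the regime letters -/

section PsiClause

variable {𝔄 : Type*} [NormedRing 𝔄] [NormedAlgebra ℂ 𝔄] [CompleteSpace 𝔄]
  {B : Type*} [Fintype B] {Z P : Type*}
  {𝒴 𝒵 : Type*} [NormedAddCommGroup 𝒴] [NormedSpace ℂ 𝒴] [CompleteSpace 𝒴]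
  [NormedAddCommGroup 𝒵] [NormedSpace ℂ 𝒵] [CompleteSpace 𝒵]
  {𝔉 : Type*} [NormedAddCommGroup 𝔉] [NormedSpace ℂ 𝔉]
  {E : Type*} [NormedAddCommGroup E] [NormedSpace ℂ E]

/-- ★★-R **READINGS OF THE MINIMISER ARE DIFFERENTIABLE, FROM THE REGIME LETTERS** (abstract open set `D` of block data):
for every exterior `z`, data `𝒢 z V`, `Λ z V`, `W z V`, `J z V`, `AH z V` (print's `𝔊`, linear term, `(δ∕δA′)V`, `J`,
`H₁B`) under a UNIFORM `Regime` on `D` with `‖J‖ ≤ j`, `‖H₁B‖ < a`, analytic in `V` on `D`, a fine chart `Φ z` jointly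
analytic on `D ×ˢ {‖Y‖ < ε₄ + a}`, a selector READING the solution (`Umin z V = Φ z V (𝒜 z V + H₁B z V)` on `D`) and
readings `read q` ℂ-differentiable at the values ⇒ `V ↦ read q (Umin z V)` is ℂ-differentiable on `D` (§1 + congruence).
[cite: Balaban1985Variational, Prop. 6 pp.295-296, p.309] [bookkeeping] -/
theorem psiClause_differentiableOn_of_regime {D : Set (B → 𝔄)} (hD : IsOpen D)
    (𝒢 : Z → (B → 𝔄) → (𝒵 →L[ℂ] 𝒴)) (Λ : Z → (B → 𝔄) → (𝒴 →L[ℂ] 𝒴)) (W : Z → (B → 𝔄) → 𝒴 → 𝒵)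
    (J : Z → (B → 𝔄) → 𝒵) (AH : Z → (B → 𝔄) → 𝒴) {B₀ θ C₄ a₃ j a ε₄ : ℝ}
    (R : ∀ z, ∀ V ∈ D, Regime (𝒢 z V) (Λ z V) (W z V) B₀ θ C₄ a₃ j a ε₄)
    (hJb : ∀ z, ∀ V ∈ D, ‖J z V‖ ≤ j) (hAb : ∀ z, ∀ V ∈ D, ‖AH z V‖ < a)
    (h𝒢 : ∀ z, AnalyticOnNhd ℂ (𝒢 z) D) (hΛ : ∀ z, AnalyticOnNhd ℂ (Λ z) D)
    (hW : ∀ z, AnalyticOnNhd ℂ (fun p : (B → 𝔄) × 𝒴 => W z p.1 p.2) (D ×ˢ {Y : 𝒴 | ‖Y‖ < a₃}))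
    (hJ : ∀ z, AnalyticOnNhd ℂ (J z) D) (hA : ∀ z, AnalyticOnNhd ℂ (AH z) D)
    (Φ : Z → (B → 𝔄) → 𝒴 → 𝔉)
    (hΦ : ∀ z, AnalyticOnNhd ℂ (fun p : (B → 𝔄) × 𝒴 => Φ z p.1 p.2) (D ×ˢ {Y : 𝒴 | ‖Y‖ < ε₄ + a}))
    (Umin : Z → (B → 𝔄) → 𝔉)
    (hUmin : ∀ z, ∀ V ∈ D, Umin z V = Φ z V (solA (𝒢 z V) (Λ z V) (W z V) (J z V) ε₄ (AH z V) + AH z V))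
    (read : P → 𝔉 → E) (hread : ∀ q z, ∀ V ∈ D, DifferentiableAt ℂ (read q) (Umin z V)) :
    ∀ q z, DifferentiableOn ℂ (fun V => read q (Umin z V)) D := by
  intro q z V hV
  have han := analyticOnNhd_read_solA hD (R z) (hJb z) (hAb z) (h𝒢 z) (hΛ z) (hW z) (hJ z) (hA z) (hΦ z)
  have hU : DifferentiableWithinAt ℂ (Umin z) D V :=
    (han V hV).differentiableAt.differentiableWithinAt.congr (fun V' hV' => hUmin z V' hV') (hUmin z V hV)
  exact (hread q z V hV).comp_differentiableWithinAt V hU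

/-- ★★′-R **THE PLAQUETTE READINGS OF THE MINIMISER, FROM THE REGIME LETTERS** — f8's `hΨd` VERBATIM for
`Ψ q z V := ∂(Umin z V)(q) − 1` on `Reg = {V | (∀ b, IsUnit (V b)) ∧ ∀ p ∈ plaqs, ‖∂V(p) − 1‖ < ε}`: fine bond variables
`Bf → 𝔄`, the selector reads the solution of (116) through the fine chart `Φ` (LOCATED: (47)'s `T` followed by the
exponential about the background), unit-valued; ★★-R + f7 `differentiableOn_plaqReading`.
[cite: Balaban1985Variational, Prop. 6 pp.295-296, (174) p.305, p.309] [bookkeeping] -/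
theorem psiClause_plaqReading_of_regime {Bf : Type*} [Fintype Bf] (plaqs : Finset (B × B × B × B)) (ε : ℝ)
    (𝒢 : Z → (B → 𝔄) → (𝒵 →L[ℂ] 𝒴)) (Λ : Z → (B → 𝔄) → (𝒴 →L[ℂ] 𝒴)) (W : Z → (B → 𝔄) → 𝒴 → 𝒵)
    (J : Z → (B → 𝔄) → 𝒵) (AH : Z → (B → 𝔄) → 𝒴) {B₀ θ C₄ a₃ j a ε₄ : ℝ}
    (R : ∀ z, ∀ V ∈ {V : B → 𝔄 | (∀ b, IsUnit (V b)) ∧ ∀ p ∈ plaqs,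
      ‖V p.1 * V p.2.1 * Ring.inverse (V p.2.2.1) * Ring.inverse (V p.2.2.2) - 1‖ < ε},
      Regime (𝒢 z V) (Λ z V) (W z V) B₀ θ C₄ a₃ j a ε₄)
    (hJb : ∀ z, ∀ V ∈ {V : B → 𝔄 | (∀ b, IsUnit (V b)) ∧ ∀ p ∈ plaqs,
      ‖V p.1 * V p.2.1 * Ring.inverse (V p.2.2.1) * Ring.inverse (V p.2.2.2) - 1‖ < ε}, ‖J z V‖ ≤ j)
    (hAb : ∀ z, ∀ V ∈ {V : B → 𝔄 | (∀ b, IsUnit (V b)) ∧ ∀ p ∈ plaqs,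
      ‖V p.1 * V p.2.1 * Ring.inverse (V p.2.2.1) * Ring.inverse (V p.2.2.2) - 1‖ < ε}, ‖AH z V‖ < a)
    (h𝒢 : ∀ z, AnalyticOnNhd ℂ (𝒢 z) {V : B → 𝔄 | (∀ b, IsUnit (V b)) ∧ ∀ p ∈ plaqs,
      ‖V p.1 * V p.2.1 * Ring.inverse (V p.2.2.1) * Ring.inverse (V p.2.2.2) - 1‖ < ε})
    (hΛ : ∀ z, AnalyticOnNhd ℂ (Λ z) {V : B → 𝔄 | (∀ b, IsUnit (V b)) ∧ ∀ p ∈ plaqs,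
      ‖V p.1 * V p.2.1 * Ring.inverse (V p.2.2.1) * Ring.inverse (V p.2.2.2) - 1‖ < ε})
    (hW : ∀ z, AnalyticOnNhd ℂ (fun p : (B → 𝔄) × 𝒴 => W z p.1 p.2)
      ({V : B → 𝔄 | (∀ b, IsUnit (V b)) ∧ ∀ p ∈ plaqs,
        ‖V p.1 * V p.2.1 * Ring.inverse (V p.2.2.1) * Ring.inverse (V p.2.2.2) - 1‖ < ε} ×ˢ {Y : 𝒴 | ‖Y‖ < a₃}))
    (hJ : ∀ z, AnalyticOnNhd ℂ (J z) {V : B → 𝔄 | (∀ b, IsUnit (V b)) ∧ ∀ p ∈ plaqs,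
      ‖V p.1 * V p.2.1 * Ring.inverse (V p.2.2.1) * Ring.inverse (V p.2.2.2) - 1‖ < ε})
    (hA : ∀ z, AnalyticOnNhd ℂ (AH z) {V : B → 𝔄 | (∀ b, IsUnit (V b)) ∧ ∀ p ∈ plaqs,
      ‖V p.1 * V p.2.1 * Ring.inverse (V p.2.2.1) * Ring.inverse (V p.2.2.2) - 1‖ < ε})
    (Φ : Z → (B → 𝔄) → 𝒴 → (Bf → 𝔄))
    (hΦ : ∀ z, AnalyticOnNhd ℂ (fun p : (B → 𝔄) × 𝒴 => Φ z p.1 p.2)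
      ({V : B → 𝔄 | (∀ b, IsUnit (V b)) ∧ ∀ p ∈ plaqs,
        ‖V p.1 * V p.2.1 * Ring.inverse (V p.2.2.1) * Ring.inverse (V p.2.2.2) - 1‖ < ε} ×ˢ
          {Y : 𝒴 | ‖Y‖ < ε₄ + a}))
    (Umin : Z → (B → 𝔄) → (Bf → 𝔄))
    (hUmin : ∀ z, ∀ V ∈ {V : B → 𝔄 | (∀ b, IsUnit (V b)) ∧ ∀ p ∈ plaqs,
      ‖V p.1 * V p.2.1 * Ring.inverse (V p.2.2.1) * Ring.inverse (V p.2.2.2) - 1‖ < ε},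
      Umin z V = Φ z V (solA (𝒢 z V) (Λ z V) (W z V) (J z V) ε₄ (AH z V) + AH z V))
    (hunit : ∀ z, ∀ V ∈ {V : B → 𝔄 | (∀ b, IsUnit (V b)) ∧ ∀ p ∈ plaqs,
      ‖V p.1 * V p.2.1 * Ring.inverse (V p.2.2.1) * Ring.inverse (V p.2.2.2) - 1‖ < ε}, ∀ b, IsUnit (Umin z V b)) :
    ∀ (q : Bf × Bf × Bf × Bf) (z : Z), DifferentiableOn ℂ
      (fun V => Umin z V q.1 * Umin z V q.2.1 * Ring.inverse (Umin z V q.2.2.1) * Ring.inverse (Umin z V q.2.2.2) - 1)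
      {V : B → 𝔄 | (∀ b, IsUnit (V b)) ∧ ∀ p ∈ plaqs,
        ‖V p.1 * V p.2.1 * Ring.inverse (V p.2.2.1) * Ring.inverse (V p.2.2.2) - 1‖ < ε} :=
  psiClause_differentiableOn_of_regime (isOpen_regularConfigs (𝔄 := 𝔄) plaqs ε) 𝒢 Λ W J AH R hJb hAb h𝒢 hΛ hW hJ hA
    Φ hΦ Umin hUmin
    (fun q (U : Bf → 𝔄) => U q.1 * U q.2.1 * Ring.inverse (U q.2.2.1) * Ring.inverse (U q.2.2.2) - 1)
    (fun q z V hV => ((differentiableOn_plaqReading (𝔄 := 𝔄) q).differentiableAt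
      (isOpen_unitConfigs.mem_nhds (hunit z V hV))).sub_const 1)

end PsiClause

/-! ## §3  Junction BY NAME: part 34's `hRT` through the exponential block chart, `hΨd` DISCHARGED into regime letters -/

section Junction

variable {𝔄 : Type*} [NormedRing 𝔄] [NormedAlgebra ℂ 𝔄] [CompleteSpace 𝔄] [NormOneClass 𝔄]
  {κ B Bf : Type*} [Fintype κ] [Fintype B] [Fintype Bf] {Z : Type*}
  {𝒴 𝒵 : Type*} [NormedAddCommGroup 𝒴] [NormedSpace ℂ 𝒴] [CompleteSpace 𝒴]
  [NormedAddCommGroup 𝒵] [NormedSpace ℂ 𝒵] [CompleteSpace 𝒵]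

/-- ★★★-R **PART 34's `hRT` THROUGH THE EXPONENTIAL BLOCK CHART, THE NODE-O CLAUSE's DIFFERENTIABILITY HALF DISCHARGED
INTO [14] PROP. 6's REGIME LETTERS** — f8 ★★★ `hRT_of_blockExpChart_regular` BY NAME at `Ψ q z V := ∂(Umin z V)(q) − 1`
with `hΨd := ★★′-R`; displayed instead: the uniform `Regime` on `Reg` ((117)–(121)), data bounds, analyticity of
`𝔊, Λ, (δ∕δA′)V, J, H₁B` in the block variables (p. 309), the fine chart `Φ`, the reading identity, unit values, and
`hΨS` ([14] Thm 1 (8), LOCATED); every other binder of f8 verbatim; (α) NOT proved.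
[cite: Balaban1985Variational, Prop. 6 pp.295-296, p.309, Thm 1 (8) p.279] [bookkeeping] -/
theorem hRT_of_blockExpChart_regular_of_regime [Nonempty Bf]
    (Xd : Z → κ → B → 𝔄) (V₀ : Z → B → 𝔄ˣ)
    {Ξ v v' r S δ ε ϱ R c₀ θ ρ κ₀ : ℝ} (hΞ0 : 0 ≤ Ξ) (hΞ : ∀ z b, ∑ a, ‖Xd z a b‖ ≤ Ξ) (hv0 : 0 ≤ v)
    (hv : ∀ z b, ‖(V₀ z b : 𝔄)‖ ≤ v) (hv' : ∀ z b, ‖(↑(V₀ z b)⁻¹ : 𝔄)‖ ≤ v') (hr : 0 < r) (hS0 : 0 ≤ S)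
    (hsmall : Ξ * Real.exp ((ϱ + r) * Ξ) * v * r * (v' * Real.exp (ϱ * Ξ)) ≤ 1 / 2)
    (plaqs : Finset (B × B × B × B))
    (hbudget : δ + max (Real.exp (ϱ * Ξ) * v + Ξ * Real.exp ((ϱ + r) * Ξ) * v * r)
        (2 * (v' * Real.exp (ϱ * Ξ))) ^ 3 * (2 + 4 * (v' * Real.exp (ϱ * Ξ)) ^ 2) *
        (Ξ * Real.exp ((ϱ + r) * Ξ) * v * r) < ε)
    (𝒢 : Z → (B → 𝔄) → (𝒵 →L[ℂ] 𝒴)) (Λ : Z → (B → 𝔄) → (𝒴 →L[ℂ] 𝒴)) (W : Z → (B → 𝔄) → 𝒴 → 𝒵)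
    (J : Z → (B → 𝔄) → 𝒵) (AH : Z → (B → 𝔄) → 𝒴) {B₀ θ₁ C₄ a₃ j a ε₄ : ℝ}
    (hR : ∀ z, ∀ V ∈ {V : B → 𝔄 | (∀ b, IsUnit (V b)) ∧ ∀ p ∈ plaqs,
      ‖V p.1 * V p.2.1 * Ring.inverse (V p.2.2.1) * Ring.inverse (V p.2.2.2) - 1‖ < ε},
      Regime (𝒢 z V) (Λ z V) (W z V) B₀ θ₁ C₄ a₃ j a ε₄)
    (hJb : ∀ z, ∀ V ∈ {V : B → 𝔄 | (∀ b, IsUnit (V b)) ∧ ∀ p ∈ plaqs,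
      ‖V p.1 * V p.2.1 * Ring.inverse (V p.2.2.1) * Ring.inverse (V p.2.2.2) - 1‖ < ε}, ‖J z V‖ ≤ j)
    (hAb : ∀ z, ∀ V ∈ {V : B → 𝔄 | (∀ b, IsUnit (V b)) ∧ ∀ p ∈ plaqs,
      ‖V p.1 * V p.2.1 * Ring.inverse (V p.2.2.1) * Ring.inverse (V p.2.2.2) - 1‖ < ε}, ‖AH z V‖ < a)
    (h𝒢 : ∀ z, AnalyticOnNhd ℂ (𝒢 z) {V : B → 𝔄 | (∀ b, IsUnit (V b)) ∧ ∀ p ∈ plaqs,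
      ‖V p.1 * V p.2.1 * Ring.inverse (V p.2.2.1) * Ring.inverse (V p.2.2.2) - 1‖ < ε})
    (hΛ : ∀ z, AnalyticOnNhd ℂ (Λ z) {V : B → 𝔄 | (∀ b, IsUnit (V b)) ∧ ∀ p ∈ plaqs,
      ‖V p.1 * V p.2.1 * Ring.inverse (V p.2.2.1) * Ring.inverse (V p.2.2.2) - 1‖ < ε})
    (hW : ∀ z, AnalyticOnNhd ℂ (fun p : (B → 𝔄) × 𝒴 => W z p.1 p.2)
      ({V : B → 𝔄 | (∀ b, IsUnit (V b)) ∧ ∀ p ∈ plaqs,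
        ‖V p.1 * V p.2.1 * Ring.inverse (V p.2.2.1) * Ring.inverse (V p.2.2.2) - 1‖ < ε} ×ˢ {Y : 𝒴 | ‖Y‖ < a₃}))
    (hJ : ∀ z, AnalyticOnNhd ℂ (J z) {V : B → 𝔄 | (∀ b, IsUnit (V b)) ∧ ∀ p ∈ plaqs,
      ‖V p.1 * V p.2.1 * Ring.inverse (V p.2.2.1) * Ring.inverse (V p.2.2.2) - 1‖ < ε})
    (hA : ∀ z, AnalyticOnNhd ℂ (AH z) {V : B → 𝔄 | (∀ b, IsUnit (V b)) ∧ ∀ p ∈ plaqs,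
      ‖V p.1 * V p.2.1 * Ring.inverse (V p.2.2.1) * Ring.inverse (V p.2.2.2) - 1‖ < ε})
    (Φ : Z → (B → 𝔄) → 𝒴 → (Bf → 𝔄))
    (hΦ : ∀ z, AnalyticOnNhd ℂ (fun p : (B → 𝔄) × 𝒴 => Φ z p.1 p.2)
      ({V : B → 𝔄 | (∀ b, IsUnit (V b)) ∧ ∀ p ∈ plaqs,
        ‖V p.1 * V p.2.1 * Ring.inverse (V p.2.2.1) * Ring.inverse (V p.2.2.2) - 1‖ < ε} ×ˢ
          {Y : 𝒴 | ‖Y‖ < ε₄ + a}))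
    (Umin : Z → (B → 𝔄) → (Bf → 𝔄))
    (hUmin : ∀ z, ∀ V ∈ {V : B → 𝔄 | (∀ b, IsUnit (V b)) ∧ ∀ p ∈ plaqs,
      ‖V p.1 * V p.2.1 * Ring.inverse (V p.2.2.1) * Ring.inverse (V p.2.2.2) - 1‖ < ε},
      Umin z V = Φ z V (solA (𝒢 z V) (Λ z V) (W z V) (J z V) ε₄ (AH z V) + AH z V))
    (hunit : ∀ z, ∀ V ∈ {V : B → 𝔄 | (∀ b, IsUnit (V b)) ∧ ∀ p ∈ plaqs,
      ‖V p.1 * V p.2.1 * Ring.inverse (V p.2.2.1) * Ring.inverse (V p.2.2.2) - 1‖ < ε}, ∀ b, IsUnit (Umin z V b))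
    (hΨS : ∀ (q : Bf × Bf × Bf × Bf) z, ∀ V ∈ {V : B → 𝔄 | (∀ b, IsUnit (V b)) ∧ ∀ p ∈ plaqs,
      ‖V p.1 * V p.2.1 * Ring.inverse (V p.2.2.1) * Ring.inverse (V p.2.2.2) - 1‖ < ε},
      ‖Umin z V q.1 * Umin z V q.2.1 * Ring.inverse (Umin z V q.2.2.1) * Ring.inverse (Umin z V q.2.2.2) - 1‖ ≤ S)
    (Kc : Z → Set (κ → ℝ)) (hKϱ : ∀ z, ∀ x ∈ Kc z, ‖x‖ ≤ ϱ)
    (hreg : ∀ z, ∀ x ∈ Kc z, ∀ p ∈ plaqs,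
      ‖exp (∑ a, (x a : ℂ) • Xd z a p.1) * (V₀ z p.1 : 𝔄) * (exp (∑ a, (x a : ℂ) • Xd z a p.2.1) * (V₀ z p.2.1 : 𝔄)) *
        Ring.inverse (exp (∑ a, (x a : ℂ) • Xd z a p.2.2.1) * (V₀ z p.2.2.1 : 𝔄)) *
        Ring.inverse (exp (∑ a, (x a : ℂ) • Xd z a p.2.2.2) * (V₀ z p.2.2.2 : 𝔄)) - 1‖ ≤ δ)
    (c : Z → (κ → ℝ)) (hcK : ∀ z, c z ∈ Kc z) (hKR : ∀ z, ∀ w ∈ Kc z, ‖w - c z‖ ≤ R) (hRr : 2 * R < r)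
    (hc₀ : ∀ (q : Bf × Bf × Bf × Bf) z,
      ‖Umin z (fun b => exp (∑ a, ((c z a : ℝ) : ℂ) • Xd z a b) * (V₀ z b : 𝔄)) q.1 *
        Umin z (fun b => exp (∑ a, ((c z a : ℝ) : ℂ) • Xd z a b) * (V₀ z b : 𝔄)) q.2.1 *
        Ring.inverse (Umin z (fun b => exp (∑ a, ((c z a : ℝ) : ℂ) • Xd z a b) * (V₀ z b : 𝔄)) q.2.2.1) *
        Ring.inverse (Umin z (fun b => exp (∑ a, ((c z a : ℝ) : ℂ) • Xd z a b) * (V₀ z b : 𝔄)) q.2.2.2) - 1‖ ≤ c₀)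
    {C : Set (Z × (κ → ℝ))} (hCK : ∀ p ∈ C, p.2 ∈ Kc p.1)
    (hnum : c₀ + 4 * (2 * (2 * S) / r ^ 2) * R ^ 2 ≤ (1 - κ₀) * (θ * (1 - ρ))) :
    let Ψ : (Bf × Bf × Bf × Bf) → Z → (B → 𝔄) → 𝔄 := fun q z V =>
      Umin z V q.1 * Umin z V q.2.1 * Ring.inverse (Umin z V q.2.2.1) * Ring.inverse (Umin z V q.2.2.2) - 1
    ∀ p : Z × (κ → ℝ), θ * (1 - ρ) ≤ (⨆ q, ‖Ψ q p.1 (fun b => exp (∑ a, ((p.2 a : ℝ) : ℂ) • Xd p.1 a b) * (V₀ p.1 b : 𝔄))‖) → (⨆ q, ‖Ψ q p.1 (fun b => exp (∑ a, ((p.2 a : ℝ) : ℂ) • Xd p.1 a b) * (V₀ p.1 b : 𝔄))‖) < θ → p ∈ C → ∀ s : ℝ, 1 ≤ s →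
      θ * (1 - ρ) ≤ (⨆ q, ‖Ψ q p.1 (fun b => exp (∑ a, (((c p.1 + s • (p.2 - c p.1)) a : ℝ) : ℂ) • Xd p.1 a b) * (V₀ p.1 b : 𝔄))‖) → (⨆ q, ‖Ψ q p.1 (fun b => exp (∑ a, (((c p.1 + s • (p.2 - c p.1)) a : ℝ) : ℂ) • Xd p.1 a b) * (V₀ p.1 b : 𝔄))‖) < θ → (p.1, c p.1 + s • (p.2 - c p.1)) ∈ C →
        (⨆ q, ‖Ψ q p.1 (fun b => exp (∑ a, ((p.2 a : ℝ) : ℂ) • Xd p.1 a b) * (V₀ p.1 b : 𝔄))‖) + κ₀ * (θ * (1 - ρ)) * (s - 1) ≤ (⨆ q, ‖Ψ q p.1 (fun b => exp (∑ a, (((c p.1 + s • (p.2 - c p.1)) a : ℝ) : ℂ) • Xd p.1 a b) * (V₀ p.1 b : 𝔄))‖) := by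
  intro Ψ
  exact hRT_of_blockExpChart_regular Xd V₀ hΞ0 hΞ hv0 hv hv' hr hS0 hsmall plaqs hbudget Ψ
    (psiClause_plaqReading_of_regime plaqs ε 𝒢 Λ W J AH hR hJb hAb h𝒢 hΛ hW hJ hA Φ hΦ Umin hUmin hunit)
    (fun q z V hV => hΨS q z V hV) Kc hKϱ hreg c hcK hKR hRr (fun q z => hc₀ q z) hCK hnum

end Junction

/-! ## §4  A2∕A6: the regime binder system of ★★′-R ∕ ★★★-R is jointly inhabited in every `𝔄` — the level-0 data -/

section Witness

variable {𝔄 : Type*} [NormedRing 𝔄] [NormedAlgebra ℂ 𝔄] [CompleteSpace 𝔄] {B : Type*} [Fintype B] {Z : Type*}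

omit [CompleteSpace 𝔄] in
/-- **A2∕A6 — THE LEVEL-0 REGIME INHABITS THE BINDER SYSTEM KEPT BY ★★′-R ∕ ★★★-R**: with carriers `𝒴 = 𝒵 := B → 𝔄`,
ZERO data `𝒢 = 0`, `Λ = 0`, `W = 0`, `J = 0`, `H₁B = 0`, letters `B₀ = θ = C₄ = j = ε₄ = 0`, `a = 1`, `a₃ = 2` (so
`Regime 0 0 0 0 0 0 2 0 1 0`: (117)–(121) hold trivially), the fine chart `Φ z V Y := V` (first projection) and the
selector `Umin z V := V`, ALL binders this file introduces (regime rows on `Reg`, data bounds, the seven analyticity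
letters, the reading identity `Umin = Φ (𝒜 + H₁B)`, unit values) hold — in EVERY `𝔄`, so ★★′-R ∕ ★★★-R are not vacuous in
them.  HONESTLY LABELLED level 0: the genuine data — [14]'s `𝔊`, `(δ∕δA′)V`, `J`, `H₁B` and the exponential fine chart AT
NODE 00's objects — are NODE O's ∕ the definers' objects; nothing about them is asserted; f8's remaining binders (`hΨS`,
budgets, cut letters) are f8's own currency, untouched. [bookkeeping] -/
theorem regime_levelZero_witness (plaqs : Finset (B × B × B × B)) (ε : ℝ) :
    ∃ (𝒢 : Z → (B → 𝔄) → ((B → 𝔄) →L[ℂ] (B → 𝔄))) (Λ : Z → (B → 𝔄) → ((B → 𝔄) →L[ℂ] (B → 𝔄)))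
      (W : Z → (B → 𝔄) → (B → 𝔄) → (B → 𝔄)) (J : Z → (B → 𝔄) → (B → 𝔄)) (AH : Z → (B → 𝔄) → (B → 𝔄))
      (Φ : Z → (B → 𝔄) → (B → 𝔄) → (B → 𝔄)) (Umin : Z → (B → 𝔄) → (B → 𝔄)) (B₀ θ C₄ a₃ j a ε₄ : ℝ),
      (∀ z : Z, ∀ V ∈ {V : B → 𝔄 | (∀ b, IsUnit (V b)) ∧ ∀ p ∈ plaqs,
          ‖V p.1 * V p.2.1 * Ring.inverse (V p.2.2.1) * Ring.inverse (V p.2.2.2) - 1‖ < ε},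
        Regime (𝒢 z V) (Λ z V) (W z V) B₀ θ C₄ a₃ j a ε₄) ∧
      (∀ z : Z, ∀ V ∈ {V : B → 𝔄 | (∀ b, IsUnit (V b)) ∧ ∀ p ∈ plaqs,
          ‖V p.1 * V p.2.1 * Ring.inverse (V p.2.2.1) * Ring.inverse (V p.2.2.2) - 1‖ < ε}, ‖J z V‖ ≤ j) ∧
      (∀ z : Z, ∀ V ∈ {V : B → 𝔄 | (∀ b, IsUnit (V b)) ∧ ∀ p ∈ plaqs,
          ‖V p.1 * V p.2.1 * Ring.inverse (V p.2.2.1) * Ring.inverse (V p.2.2.2) - 1‖ < ε}, ‖AH z V‖ < a) ∧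
      (∀ z : Z, AnalyticOnNhd ℂ (𝒢 z) {V : B → 𝔄 | (∀ b, IsUnit (V b)) ∧ ∀ p ∈ plaqs,
          ‖V p.1 * V p.2.1 * Ring.inverse (V p.2.2.1) * Ring.inverse (V p.2.2.2) - 1‖ < ε}) ∧
      (∀ z : Z, AnalyticOnNhd ℂ (Λ z) {V : B → 𝔄 | (∀ b, IsUnit (V b)) ∧ ∀ p ∈ plaqs,
          ‖V p.1 * V p.2.1 * Ring.inverse (V p.2.2.1) * Ring.inverse (V p.2.2.2) - 1‖ < ε}) ∧
      (∀ z : Z, AnalyticOnNhd ℂ (fun p : (B → 𝔄) × (B → 𝔄) => W z p.1 p.2)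
          ({V : B → 𝔄 | (∀ b, IsUnit (V b)) ∧ ∀ p ∈ plaqs,
            ‖V p.1 * V p.2.1 * Ring.inverse (V p.2.2.1) * Ring.inverse (V p.2.2.2) - 1‖ < ε} ×ˢ
              {Y : B → 𝔄 | ‖Y‖ < a₃})) ∧
      (∀ z : Z, AnalyticOnNhd ℂ (J z) {V : B → 𝔄 | (∀ b, IsUnit (V b)) ∧ ∀ p ∈ plaqs,
          ‖V p.1 * V p.2.1 * Ring.inverse (V p.2.2.1) * Ring.inverse (V p.2.2.2) - 1‖ < ε}) ∧
      (∀ z : Z, AnalyticOnNhd ℂ (AH z) {V : B → 𝔄 | (∀ b, IsUnit (V b)) ∧ ∀ p ∈ plaqs,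
          ‖V p.1 * V p.2.1 * Ring.inverse (V p.2.2.1) * Ring.inverse (V p.2.2.2) - 1‖ < ε}) ∧
      (∀ z : Z, AnalyticOnNhd ℂ (fun p : (B → 𝔄) × (B → 𝔄) => Φ z p.1 p.2)
          ({V : B → 𝔄 | (∀ b, IsUnit (V b)) ∧ ∀ p ∈ plaqs,
            ‖V p.1 * V p.2.1 * Ring.inverse (V p.2.2.1) * Ring.inverse (V p.2.2.2) - 1‖ < ε} ×ˢ
              {Y : B → 𝔄 | ‖Y‖ < ε₄ + a})) ∧
      (∀ z : Z, ∀ V ∈ {V : B → 𝔄 | (∀ b, IsUnit (V b)) ∧ ∀ p ∈ plaqs,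
          ‖V p.1 * V p.2.1 * Ring.inverse (V p.2.2.1) * Ring.inverse (V p.2.2.2) - 1‖ < ε},
        Umin z V = Φ z V (solA (𝒢 z V) (Λ z V) (W z V) (J z V) ε₄ (AH z V) + AH z V)) ∧
      (∀ z : Z, ∀ V ∈ {V : B → 𝔄 | (∀ b, IsUnit (V b)) ∧ ∀ p ∈ plaqs,
          ‖V p.1 * V p.2.1 * Ring.inverse (V p.2.2.1) * Ring.inverse (V p.2.2.2) - 1‖ < ε}, ∀ b, IsUnit (Umin z V b)) := by
  refine ⟨fun _ _ => 0, fun _ _ => 0, fun _ _ _ => 0, fun _ _ => 0, fun _ _ => 0, fun _ V _ => V, fun _ V => V,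
    0, 0, 0, 2, 0, 1, 0, fun _ V _ => ?_, fun _ V _ => by simp, fun _ V _ => by simp,
    fun _ => analyticOnNhd_const, fun _ => analyticOnNhd_const, fun _ => analyticOnNhd_const,
    fun _ => analyticOnNhd_const, fun _ => analyticOnNhd_const, fun _ => fun p _ => analyticAt_fst,
    fun _ V _ => rfl, fun _ V hV => hV.1⟩
  -- the level-0 regime: (117)–(121) at zero data and letters `B₀ = θ = C₄ = j = ε₄ = 0`, `a = 1`, `a₃ = 2`
  exact ⟨fun f => by simp, fun Y => by simp, ⟨fun Y _ => by simp, fun P Q => differentiableOn_const _⟩,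
    le_rfl, le_rfl, le_rfl, le_rfl, by norm_num, by norm_num, by norm_num⟩

end Witness

end Summit.QuantumFields.YangMills.Theorems.N21MinimiserResponseRegime
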